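import Summits.KontsevichZagierPeriods.KontsevichZagierPeriods.Theorems.SoloInformedKappaSpan
import Summits.KontsevichZagierPeriods.KontsevichZagierPeriods.Theorems.SoloInformedPlanarBands

/-!
# The curve sector is decided one dimension down: the fibre-length reduction (Theorem XVI-K)

Solo programme `solo-KontsevichZagierPeriods-informed`, session s31, line "the curve sector"
(`SoloInformedCurveSector.lean`, Theorem XV: Huber–Wüstholz decides the Kontsevich–Zagier
conjecture on every class of representations whose `Per` lies in `soloInformedKappaSpan`).

This file is the kernel half of the mechanism by which volumes of solids enter the sector
(Theorem XVI of `paper/paper.md` §6novies): for a volume representation `r = [S, 1]` of dimension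
`m + 1` (any `ℚ`-semialgebraic `S` of finite volume, no compactness needed),

  `[S, 1] ≡ Σ_C [C, L_S|_C]`  modulo the Kontsevich–Zagier relations,

where `C` runs over the positive-volume cells of a cylindrical decomposition of `ℝ^m` adapted to
`S` and `L_S(x) = vol {t | (x, t) ∈ S}` is the length of the last-coordinate fibre
(`soloInformed_cell_base`: rules (1) and (3) of [KZ 2001, §1.2] down the inner bands, then
`KZ.volume_fibre_eq_ofReal_sum`). Consequently (`soloInformed_per_mem_span_of_fibreLength`):

  if every representation `[C, L_S|_C]` of dimension `m` with integrand the fibre length of `S`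
  has its `Per` in the sector, then so does `[S, 1]`.

So membership of a solid `K ⊆ ℝ³` in the curve sector — hence Rung 3 of the volume ladder on the
class of such solids, granted Huber–Wüstholz (`soloInformed_volumeRung_on_class_of_mem_span`) — is
a statement about the planar representations `[C, L_K]`; the paper's Green criterion (Theorem
XVI (a)) and the exactness of the volume class of the boundary surfaces (Theorem XVI (c)) are
sufficient conditions for those (the weighted form of `soloInformed_planarBands` needed to make
the polynomial-graph instance kernel is recorded as the next target in `paper/paper.md` §6novies).

References: M. Kontsevich, D. Zagier, *Periods* (2001), §1.2 [KontsevichZagier2001];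
S. Basu, R. Pollack, M.-F. Roy, *Algorithms in Real Algebraic Geometry* (2006), Cor. 5.7;
A. Huber, G. Wüstholz, *Transcendence and linear relations of 1-periods* (2022) [HuberWuestholz2022].
-/

noncomputable section

open MeasureTheory Set
open Literature.ModelTheory.ExponentialFields Literature.NumberTheory.Transcendental
open Literature.NumberTheory.Transcendental.KZ

namespace Summit.KontsevichZagierPeriods.KontsevichZagierPeriods.Theorems

/-- Equivalent representations of possibly different dimensions have the same `Per`
(`soloInformedPer_congr` is the equal-dimension case). -/
theorem soloInformedPer_congr_het {n n' : ℕ} {ρ : IntegralRep n} {ρ' : IntegralRep n'}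
    (h : of ρ - of ρ' ∈ relations) : soloInformedPer ρ = soloInformedPer ρ' := by
  simp only [soloInformedPer, toFormalPeriod_eq_iff.2 h]

/-- **Fibre-length reduction.** Let `r = [S, 1]` be a volume representation of dimension `m + 1`.
If every representation of dimension `m` whose integrand is, on its domain, the length of the
last-coordinate fibre of `S` has its `Per` in the curve sector `soloInformedKappaSpan`, then
`Per r` lies in the sector. Proof: cut `S` along the cylinders over the cells of a cylindrical
decomposition of `ℝ^m` adapted to `S` (rule (1)); the pieces over null cells are relations; over a
cell `C` of positive volume, `[S ∩ (C × ℝ), 1] ≡ [C, Σ_j (ξ_j − ξ_{j-1})]` by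
`soloInformed_cell_base` (rules (1), (3)), and the integrand is the fibre length by
`KZ.volume_fibre_eq_ofReal_sum`. [Kontsevich–Zagier 2001, §1.2, rules (1), (3)] -/
theorem soloInformed_per_mem_span_of_fibreLength {m : ℕ} (r : IntegralRep (m + 1))
    (hr1 : ∀ x ∈ r.domain, r.integrand x = 1)
    (hfib : ∀ ρ : IntegralRep m,
      (∀ x ∈ ρ.domain, ρ.integrand x = (volume (FibreLength.fibre r.domain x)).toReal) →
      soloInformedPer ρ ∈ soloInformedKappaSpan) :
    soloInformedPer r ∈ soloInformedKappaSpan := by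
  classical
  have hS : IsSemialgebraic ℚ r.domain := r.isSemialgebraic_domain
  have hfin : volume r.domain ≠ ⊤ := volume_ne_top_of_integrand_one r hr1
  obtain ⟨𝒮, l, ξ, hcd, -, hξ, hmono, hcells, hfibS⟩ :=
    IsSemialgebraic.exists_cylindricalDecomposition.exists_fibre_eq
      (IsSemialgebraic.exists_cylindricalDecomposition_holds (k := ℚ)) hS
  have hpart := hcd.isPartition
  have h𝒮sa := hcd.isSemialgebraic
  -- the pieces of `r` over the cells
  let RC : {C // C ∈ 𝒮} → IntegralRep (m + 1) := fun C =>
    r.restrict (r.domain ∩ {z | Fin.init z ∈ (C : Set (Fin m → ℝ))})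
      (hS.inter (h𝒮sa C C.2).setOf_init_mem) inter_subset_left
  have e0 : of r - ∑ C ∈ 𝒮.attach, of (RC C) ∈ relations :=
    of_sub_sum_cyl_mem_relations r 𝒮 hpart RC (fun C => rfl) fun C x _ => rfl
  -- per cell
  have hcell : ∀ C : {C // C ∈ 𝒮}, soloInformedPer (RC C) ∈ soloInformedKappaSpan := by
    intro C
    by_cases hC0 : volume (C : Set (Fin m → ℝ)) = 0
    · -- a null cell: the cylinder piece is a relation, its `Per` vanishes
      have hrel : of (RC C) ∈ relations :=
        of_mem_relations_of_volume_eq_zero _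
          (measure_mono_null inter_subset_right (KZ.volume_setOf_init_mem_eq_zero hC0))
      have h0 : soloInformedPer (RC C) = 0 := by
        simp only [soloInformedPer, toFormalPeriod_eq_zero_of_mem hrel]
        ext <;> simp [SoloInformedV.fst_mk, SoloInformedV.snd_mk]
      rw [h0]
      exact zero_mem _
    · -- a cell of positive volume: down the bands to `[C, fibre length]`
      obtain ⟨G, B, -, hBsub, hfibC⟩ := hfibS C C.2
      obtain ⟨bL, hbLd, hbLi, hinner, hrel⟩ := soloInformed_cell_base hS hfin (h𝒮sa C C.2) hC0
        (ξ C) (hξ C C.2) (hmono C C.2) G B hBsub (hcells C C.2).2 hfibC (RC C) rfl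
        fun x hx => hr1 x hx.1
      have key : soloInformedPer (RC C) = soloInformedPer bL := soloInformedPer_congr_het hrel
      have hbL : soloInformedPer bL ∈ soloInformedKappaSpan := by
        refine hfib bL fun x hx => ?_
        rw [hbLd] at hx
        rw [hbLi, KZ.volume_fibre_eq_ofReal_sum (S := r.domain) (ξ C) (hmono C C.2 x hx) G B
          hinner (hfibC x hx), ENNReal.toReal_ofReal]
        exact Finset.sum_nonneg fun j hj => sub_nonneg.2
          (toReal_bandLower_lt_toReal_bandUpper (ξ C) (hmono C C.2 x hx) (hinner j hj).1
            (hinner j hj).2).le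
      exact key ▸ hbL
  rw [soloInformedPer_sum 𝒮.attach e0]
  exact AddSubgroup.sum_mem _ fun C _ => hcell C

/-- **Rung `m + 1` on a class read off one dimension down.** If for every member `r` of a class
`𝒞` of volume representations of dimension `m + 1` all fibre-length representations of `r.domain`
are in the sector, then equal volumes in `𝒞` give Kontsevich–Zagier equivalent representations,
granted Huber–Wüstholz — by the reduction above and Theorem XV
(`soloInformed_per_mem_span_of_fibreLength`; the conclusion is stated through `Per`, so that this
file does not depend on `SoloInformedCurveSector.lean`). -/
theorem soloInformed_per_mem_span_of_fibreLength_class {m : ℕ} {𝒞 : Set (IntegralRep (m + 1))}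
    (h1 : ∀ r ∈ 𝒞, ∀ x ∈ r.domain, r.integrand x = 1)
    (hfib : ∀ r ∈ 𝒞, ∀ ρ : IntegralRep m,
      (∀ x ∈ ρ.domain, ρ.integrand x = (volume (FibreLength.fibre r.domain x)).toReal) →
      soloInformedPer ρ ∈ soloInformedKappaSpan) :
    ∀ r ∈ 𝒞, soloInformedPer r ∈ soloInformedKappaSpan := fun r hr =>
  soloInformed_per_mem_span_of_fibreLength r (h1 r hr) (hfib r hr)

end Summit.KontsevichZagierPeriods.KontsevichZagierPeriods.Theorems
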